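import Summits.Ventures.PackingBounds.Energy.ThreePointCertEnergy
import Summits.Ventures.PackingBounds.ThreePointCert.SoundExactChecks
import Literature.Geometry.DiscreteGeometry.ThreePointEnergyBound

/-!
# Soundness of the kernel checker for exact three-point ENERGY certificates

Framing: lottery ticket; floor = certified bounds/negative ranges. Venture `PackingBounds`
(cell `pub-packcert`), energy family E3PT (pub-packcert-energy gen 27; KERNEL-DIPLO route).

Meaning of the programs of `Energy.ThreePointCertEnergy` and the soundness theorem
`energy_ge_of_certE`: if an energy certificate `c : CertE` with claimed expansions `P : PolysE`
passes `checkSideE`, `checkIdE`, `checkValE`, and the expansions are validated (`PolysOKE`: the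
three-point expansion by `ThreePointCert.FchunkOKX`, each sum-of-squares group by the row-chunk
checks `ThreePointCert.partChunkOK(D)` composed with `SoundExactParts.partsValFrom_cons`), then for
every `c.N`-point configuration `C` of unit vectors of `ℝⁿ` (`n = c.n ≥ 4`)
`bNum/bDen ≤ Σ_{x ≠ y ∈ C} p(x·y)`, where `p = pval c` is the certificate's polynomial potential.
The bound is Cohn–Woo's Theorem 3.2 in the abstract form
`Literature.Geometry.DiscreteGeometry.CohnWoo.energy_ge_of_threePoint` [cite: CohnWoo2012, Theorem 3.2],
with Bachoc–Vallentin's positivity of the three-point part (`tripleSum_FvalX_nonneg`, all `n ≥ 4`)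
and of the Gegenbauer two-point part (`pairSum_AvalG_nonneg`) — no named-fact hypothesis.
A Hermite-minorant lemma `p ≤ f` then transfers the bound to the true potential `f` in each
instance file.
-/

noncomputable section

open Finset
open scoped RealInnerProductSpace

namespace Summit.Ventures.PackingBounds.Energy.ThreePointCertE

open Literature.Geometry.DiscreteGeometry Literature.Geometry.DiscreteGeometry.PolyCert
open Literature.Geometry.DiscreteGeometry.PolyCert.SPoly
open Literature.Analysis.SpecialFunctions
open Summit.Ventures.PackingBounds.ThreePointCert

/-! ### Real meaning of a certificate -/

/-- The polynomial potential `p(u) = (Σ_i pP[i] u^i) / pDen`. -/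
def pval (c : CertE) (u : ℝ) : ℝ :=
  (∑ i ∈ range c.pP.length, (c.pP.getD i 0 : ℝ) * u ^ i) / c.pDen

/-- The constant `c = cNum / cDen`. -/
def cval (c : CertE) : ℝ := (c.cNum : ℝ) / c.cDen

/-- The two-point function `A(u) = AvalG n A u / lamA`. -/
def AXE (c : CertE) (u : ℝ) : ℝ := AvalG c.n c.A u / c.lamA

/-- The three-point function `F = FvalX n F / lamF`. -/
def FXE (c : CertE) (u v t : ℝ) : ℝ := FvalX c.n c.F u v t / c.lamF

/-- The claimed bound `bNum / bDen`. -/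
def bval (c : CertE) : ℝ := (c.bNum : ℝ) / c.bDen

/-! ### Validated expansions -/

/-- Validity of the three-point expansion on values. -/
def FValE (c : CertE) (FP : SPoly) : Prop :=
  ∀ u v t : ℝ, eval FP u v t = eval (FPolyX c.n c.d c.F) u v t

/-- A one-chunk kernel check `FchunkOKX n d F [] FP` validates the three-point expansion. -/
theorem fvalE_of_ok (c : CertE) (FP : SPoly) (h : FchunkOKX c.n c.d c.F [] FP = true) : FValE c FP := by
  intro u v t
  have h0 := eval_eq_zero_of_allZero _ h u v t
  rw [eval_mergeAll] at h0
  simp only [List.map_cons, List.map_nil, List.sum_cons, List.sum_nil, add_zero, eval_neg, eval_nil] at h0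
  linarith

/-- Block-chunk validity of the three-point expansion (for expansions validated in several chunks). -/
def FChunkValE (c : CertE) (bs : List FBlkX) (Dprev Dnext : SPoly) : Prop :=
  ∀ u v t : ℝ, eval Dnext u v t = eval Dprev u v t + eval (FPolyX c.n c.d bs) u v t

/-- A kernel block-chunk check gives chunk validity. -/
theorem fchunkValE_of_ok (c : CertE) (bs : List FBlkX) (Dprev Dnext : SPoly)
    (h : FchunkOKX c.n c.d bs Dprev Dnext = true) : FChunkValE c bs Dprev Dnext := by
  intro u v t
  have h0 := eval_eq_zero_of_allZero _ h u v t
  rw [eval_mergeAll] at h0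
  simp only [List.map_cons, List.map_nil, List.sum_cons, List.sum_nil, add_zero, eval_neg] at h0
  linarith

/-- Consecutive block chunks compose. -/
theorem fchunkValE_append (c : CertE) (l₁ l₂ : List FBlkX) (D0 D1 D2 : SPoly)
    (h1 : FChunkValE c l₁ D0 D1) (h2 : FChunkValE c l₂ D1 D2) : FChunkValE c (l₁ ++ l₂) D0 D2 := by
  intro u v t
  rw [h2 u v t, h1 u v t, eval_FPolyX_append]; ring

/-- A chunk validity covering all blocks from `[]` validates the expansion. -/
theorem fvalE_of_chunks (c : CertE) (FP : SPoly) (h : FChunkValE c c.F [] FP) : FValE c FP := by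
  intro u v t; rw [h u v t, eval_nil, zero_add]

/-- Validity of all expansion data of an energy certificate. -/
structure PolysOKE (c : CertE) (P : PolysE) : Prop where
  /-- the three-point expansion -/
  hF : FValE c P.FP
  /-- every sum-of-squares group -/
  hT : ∀ g, g < c.R.length → PartsVal (c.R.getD g []) (P.TOT.getD g [])

/-! ### Unpacked side conditions -/

/-- Unpacked `checkSideE`. -/
theorem sideE_of_check (c : CertE) (hs : checkSideE c = true) :
    4 ≤ c.n ∧ 3 ≤ c.N ∧ 0 < c.Lam ∧ c.kp * (3 * c.pDen) = c.Lam ∧ c.kc * c.cDen = c.Lam ∧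
      c.kF * (Wfac c.d * c.lamF) = c.Lam ∧ c.kA * (3 * (Wfac c.d * c.lamA)) = c.Lam ∧ 0 < c.bDen ∧
      c.A.length ≤ c.d + 1 ∧ (∀ b ∈ c.F, fblkShapeOK c.d b = true) ∧
      (∀ g ∈ c.R, ∀ Pt ∈ g, partShapeOK Pt = true) ∧ c.kR.length = c.R.length := by
  unfold checkSideE at hs
  simp only [Bool.and_eq_true, decide_eq_true_eq, List.all_eq_true] at hs
  obtain ⟨⟨⟨⟨⟨⟨⟨⟨⟨⟨⟨h1, h2⟩, h3⟩, h4⟩, h5⟩, h6⟩, h7⟩, h8⟩, h9⟩, h10⟩, h11⟩, h12⟩ := hs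
  exact ⟨h1, h2, h3, h4, h5, h6, h7, h8, h9, h10, h11, h12⟩

/-! ### Values of the identity summands -/

/-- `eval (pPolyU c) u v t = pDen · p(u)` (when `pDen > 0`). -/
theorem eval_pPolyU (c : CertE) (hp : 0 < c.pDen) (u v t : ℝ) :
    eval (pPolyU c) u v t = (c.pDen : ℝ) * pval c u := by
  unfold pPolyU pval
  have hd : (c.pDen : ℝ) ≠ 0 := by exact_mod_cast hp.ne'
  rw [mul_div_cancel₀ _ hd]
  unfold eval
  rw [List.map_map, list_sum_map_range]
  refine Finset.sum_congr rfl fun i _ => ?_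
  simp [Function.comp, Mono.eval]

/-- Value of `sum3 q`: `q(u,·) + q(v,·) + q(t,·)` in the precise sense of the permutations. -/
theorem eval_sum3 (q : SPoly) (u v t : ℝ) :
    eval (sum3 q) u v t = eval q u v t + eval q v u t + eval q t v u := by
  unfold sum3
  rw [eval_normalize, eval_append, eval_append, eval_permBAC, eval_permCBA]

/-- `eval (P3 c) = pDen · (p(u) + p(v) + p(t))`. -/
theorem eval_P3 (c : CertE) (hp : 0 < c.pDen) (u v t : ℝ) :
    eval (P3 c) u v t = (c.pDen : ℝ) * (pval c u + pval c v + pval c t) := by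
  unfold P3
  rw [eval_sum3, eval_pPolyU c hp, eval_pPolyU c hp, eval_pPolyU c hp]; ring

/-- `eval (A3 c) = W · lamA · (A(u) + A(v) + A(t))`. -/
theorem eval_A3 (c : CertE) (hA : c.A.length ≤ c.d + 1) (hl : 0 < c.lamA) (u v t : ℝ) :
    eval (A3 c) u v t = (Wfac c.d : ℝ) * (c.lamA : ℝ) * (AXE c u + AXE c v + AXE c t) := by
  unfold A3 AXE
  have hd : (c.lamA : ℝ) ≠ 0 := by exact_mod_cast hl.ne'
  rw [eval_sum3, eval_APolyG c.n c.d c.A hA, eval_APolyG c.n c.d c.A hA, eval_APolyG c.n c.d c.A hA]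
  field_simp

/-- `eval (FT c FP) = W · lamF · ((N-2) F(u,v,t) + F(u,u,1) + F(v,v,1) + F(t,t,1))` for a validated `FP`. -/
theorem eval_FT (c : CertE) (FP : SPoly) (hFP : FValE c FP) (hF : ∀ b ∈ c.F, fblkShapeOK c.d b = true)
    (hl : 0 < c.lamF) (u v t : ℝ) :
    eval (FT c FP) u v t = (Wfac c.d : ℝ) * (c.lamF : ℝ) *
      ((((c.N : ℤ) - 2 : ℤ) : ℝ) * FXE c u v t + FXE c u u 1 + FXE c v v 1 + FXE c t t 1) := by
  unfold FT FXE
  have hd : (c.lamF : ℝ) ≠ 0 := by exact_mod_cast hl.ne'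
  have hev : ∀ a b e : ℝ, eval FP a b e = (Wfac c.d : ℝ) * FvalX c.n c.F a b e := fun a b e => by
    rw [hFP a b e, eval_FPolyX c.n c.d c.F hF]
  rw [eval_normalize, eval_append, eval_append, eval_append, eval_smul, eval_permBAC, eval_permCBA,
    eval_substUU1, eval_substUU1, eval_substUU1, hev, hev, hev, hev]
  field_simp
  ring

/-- Value of the group summands: `eval (zipWith (k T ↦ -k·T) ks Ts) = - Σ_g ks[g] · eval Ts[g]`. -/
theorem eval_zipWith_neg (ks : List ℕ) (Ts : List SPoly) (hlen : ks.length = Ts.length) (u v t : ℝ) :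
    ((List.zipWith (fun (k : ℕ) (T : SPoly) => smul (-(k : ℤ)) T) ks Ts).map fun q => eval q u v t).sum
      = -∑ g ∈ range ks.length, (ks.getD g 0 : ℝ) * eval (Ts.getD g []) u v t := by
  induction ks generalizing Ts with
  | nil => simp
  | cons k ks ih =>
    cases Ts with
    | nil => simp at hlen
    | cons T Ts =>
      have hl : ks.length = Ts.length := by simpa using hlen
      rw [List.zipWith_cons_cons, List.map_cons, List.sum_cons, ih Ts hl, List.length_cons,
        Finset.sum_range_succ']
      simp only [List.getD_cons_zero, List.getD_cons_succ, eval_smul]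
      push_cast
      ring

/-! ### The checks -/

/-- The evaluated identity: for a certificate passing `checkIdE` (with validated expansions),
`Λ·[(p(u)+p(v)+p(t))/3 - c - (N-2)F(u,v,t) - F(u,u,1) - F(v,v,1) - F(t,t,1) - (A(u)+A(v)+A(t))/3]
 = Σ_g kR[g] · eval TOT[g]`. -/
theorem identity_of_check (c : CertE) (P : PolysE) (hP : PolysOKE c P) (hs : checkSideE c = true)
    (hid : checkIdE c P = true) (u v t : ℝ) :
    (c.Lam : ℝ) * ((pval c u + pval c v + pval c t) / 3 - cval c
        - ((((c.N : ℤ) - 2 : ℤ) : ℝ) * FXE c u v t + FXE c u u 1 + FXE c v v 1 + FXE c t t 1)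
        - (AXE c u + AXE c v + AXE c t) / 3)
      = ∑ g ∈ range c.kR.length, (c.kR.getD g 0 : ℝ) * eval (P.TOT.getD g []) u v t := by
  obtain ⟨-, -, hLam, hkp, hkc, hkF, hkA, -, hAlen, hF, -, hkR⟩ := sideE_of_check c hs
  unfold checkIdE at hid
  simp only [Bool.and_eq_true, decide_eq_true_eq] at hid
  obtain ⟨⟨hlen1, hlen2⟩, hz⟩ := hid
  have hW : (0 : ℝ) < Wfac c.d := by exact_mod_cast Wfac_pos c.d
  have hpDen : 0 < c.pDen := by
    rcases Nat.eq_zero_or_pos c.pDen with h | h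
    · rw [h] at hkp; omega
    · exact h
  have hcDen : 0 < c.cDen := by
    rcases Nat.eq_zero_or_pos c.cDen with h | h
    · rw [h] at hkc; omega
    · exact h
  have hlamF : 0 < c.lamF := by
    rcases Nat.eq_zero_or_pos c.lamF with h | h
    · rw [h] at hkF; simp at hkF; omega
    · exact h
  have hlamA : 0 < c.lamA := by
    rcases Nat.eq_zero_or_pos c.lamA with h | h
    · rw [h] at hkA; simp at hkA; omega
    · exact h
  have h0 := eval_eq_zero_of_allZero _ hz u v t
  unfold idPolyE at h0
  rw [eval_mergeAll, List.map_append, List.sum_append,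
    eval_zipWith_neg c.kR P.TOT (by rw [hlen1, hlen2]) u v t] at h0
  simp only [List.map_cons, List.map_nil, List.sum_cons, List.sum_nil, add_zero, eval_smul, eval_C,
    eval_P3 c hpDen, eval_A3 c hAlen hlamA, eval_FT c P.FP hP.hF hF hlamF] at h0
  -- the multiplier equations, over ℝ
  have ekp : (c.kp : ℝ) * (3 * c.pDen) = c.Lam := by exact_mod_cast hkp
  have ekc : (c.kc : ℝ) * c.cDen = c.Lam := by exact_mod_cast hkc
  have ekF : (c.kF : ℝ) * (Wfac c.d * c.lamF) = c.Lam := by exact_mod_cast hkF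
  have ekA : (c.kA : ℝ) * (3 * (Wfac c.d * c.lamA)) = c.Lam := by exact_mod_cast hkA
  have hcD : (c.cDen : ℝ) ≠ 0 := by exact_mod_cast hcDen.ne'
  have hcv : (c.Lam : ℝ) * cval c = (c.kc : ℝ) * c.cNum := by
    unfold cval; rw [← ekc]; field_simp
  push_cast at h0 ⊢
  have e1 : (c.Lam : ℝ) * ((pval c u + pval c v + pval c t) / 3) = (c.kp : ℝ) * ((c.pDen : ℝ) * (pval c u + pval c v + pval c t)) := by
    rw [← ekp]; ring
  have e2 : (c.Lam : ℝ) * ((((c.N : ℝ) - 2) * FXE c u v t + FXE c u u 1 + FXE c v v 1 + FXE c t t 1))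
      = (c.kF : ℝ) * ((Wfac c.d : ℝ) * (c.lamF : ℝ) * (((c.N : ℝ) - 2) * FXE c u v t + FXE c u u 1 + FXE c v v 1 + FXE c t t 1)) := by
    rw [← ekF]; ring
  have e3 : (c.Lam : ℝ) * ((AXE c u + AXE c v + AXE c t) / 3)
      = (c.kA : ℝ) * ((Wfac c.d : ℝ) * (c.lamA : ℝ) * (AXE c u + AXE c v + AXE c t)) := by
    rw [← ekA]; ring
  have : (c.Lam : ℝ) * ((pval c u + pval c v + pval c t) / 3 - cval c
        - (((c.N : ℝ) - 2) * FXE c u v t + FXE c u u 1 + FXE c v v 1 + FXE c t t 1)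
        - (AXE c u + AXE c v + AXE c t) / 3)
      = (c.Lam : ℝ) * ((pval c u + pval c v + pval c t) / 3) - (c.Lam : ℝ) * cval c
        - (c.Lam : ℝ) * (((c.N : ℝ) - 2) * FXE c u v t + FXE c u u 1 + FXE c v v 1 + FXE c t t 1)
        - (c.Lam : ℝ) * ((AXE c u + AXE c v + AXE c t) / 3) := by ring
  rw [this, e1, hcv, e2, e3]
  linarith

/-- The value: `bNum/bDen = N((N-1)c - F(1,1,1) - A(1))`. -/
theorem value_of_check (c : CertE) (P : PolysE) (hP : PolysOKE c P) (hs : checkSideE c = true)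
    (hv : checkValE c P = true) :
    bval c = (c.N : ℝ) * (((c.N : ℝ) - 1) * cval c - FXE c 1 1 1 - AXE c 1) := by
  obtain ⟨-, -, hLam, hkp, hkc, hkF, hkA, hbDen, hAlen, hF, -, -⟩ := sideE_of_check c hs
  have h := of_decide_eq_true hv
  have hW : (0 : ℝ) < Wfac c.d := by exact_mod_cast Wfac_pos c.d
  have hcDen : 0 < c.cDen := by
    rcases Nat.eq_zero_or_pos c.cDen with h' | h'
    · rw [h'] at hkc; omega
    · exact h'
  have hlamF : 0 < c.lamF := by
    rcases Nat.eq_zero_or_pos c.lamF with h' | h'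
    · rw [h'] at hkF; simp at hkF; omega
    · exact h'
  have hlamA : 0 < c.lamA := by
    rcases Nat.eq_zero_or_pos c.lamA with h' | h'
    · rw [h'] at hkA; simp at hkA; omega
    · exact h'
  have hAv : (coeffSum (APolyG c.n c.d c.A) : ℝ) = (Wfac c.d : ℝ) * (c.lamA : ℝ) * AXE c 1 := by
    rw [← eval_one_one_one, eval_APolyG c.n c.d c.A hAlen]
    unfold AXE
    have : (c.lamA : ℝ) ≠ 0 := by exact_mod_cast hlamA.ne'
    field_simp
  have hFv : (coeffSum P.FP : ℝ) = (Wfac c.d : ℝ) * (c.lamF : ℝ) * FXE c 1 1 1 := by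
    rw [← eval_one_one_one, hP.hF 1 1 1, eval_FPolyX c.n c.d c.F hF]
    unfold FXE
    have : (c.lamF : ℝ) ≠ 0 := by exact_mod_cast hlamF.ne'
    field_simp
  have h' : (c.bNum : ℝ) * c.Lam = (c.bDen : ℝ) * ((c.N : ℝ) * (((c.N : ℝ) - 1) * ((c.kc : ℝ) * c.cNum)
      - (c.kF : ℝ) * (coeffSum P.FP : ℝ) - 3 * (c.kA : ℝ) * (coeffSum (APolyG c.n c.d c.A) : ℝ))) := by
    exact_mod_cast h
  rw [hAv, hFv] at h'
  have ekc : (c.kc : ℝ) * c.cDen = c.Lam := by exact_mod_cast hkc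
  have ekF : (c.kF : ℝ) * (Wfac c.d * c.lamF) = c.Lam := by exact_mod_cast hkF
  have ekA : (c.kA : ℝ) * (3 * (Wfac c.d * c.lamA)) = c.Lam := by exact_mod_cast hkA
  have hcv : (c.kc : ℝ) * c.cNum = (c.Lam : ℝ) * cval c := by
    unfold cval; rw [← ekc]
    have : (c.cDen : ℝ) ≠ 0 := by exact_mod_cast hcDen.ne'
    field_simp
  have hfv : (c.kF : ℝ) * ((Wfac c.d : ℝ) * (c.lamF : ℝ) * FXE c 1 1 1) = (c.Lam : ℝ) * FXE c 1 1 1 := by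
    rw [← ekF]; ring
  have hav : 3 * (c.kA : ℝ) * ((Wfac c.d : ℝ) * (c.lamA : ℝ) * AXE c 1) = (c.Lam : ℝ) * AXE c 1 := by
    rw [← ekA]; ring
  rw [hcv, hfv, hav] at h'
  have hL : (0 : ℝ) < c.Lam := by exact_mod_cast hLam
  have hbD : (0 : ℝ) < c.bDen := by exact_mod_cast hbDen
  unfold bval
  rw [div_eq_iff hbD.ne']
  have : (c.Lam : ℝ) * ((c.bNum : ℝ) - (c.N : ℝ) * (((c.N : ℝ) - 1) * cval c - FXE c 1 1 1 - AXE c 1) * c.bDen) = 0 := by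
    linarith
  rcases mul_eq_zero.1 this with h0 | h0
  · exact absurd h0 hL.ne'
  · linarith

/-- The sums of squares are nonnegative: `Σ_g kR[g] · eval TOT[g] ≥ 0`. -/
theorem groups_nonneg (c : CertE) (P : PolysE) (hP : PolysOKE c P) (hs : checkSideE c = true) (u v t : ℝ) :
    0 ≤ ∑ g ∈ range c.kR.length, (c.kR.getD g 0 : ℝ) * eval (P.TOT.getD g []) u v t := by
  obtain ⟨-, -, -, -, -, -, -, -, -, -, hR, hkR⟩ := sideE_of_check c hs
  refine Finset.sum_nonneg fun g hg => mul_nonneg (by positivity) ?_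
  rw [Finset.mem_range, hkR] at hg
  refine partsVal_nonneg _ _ (hP.hT g hg) (fun Pt hPt => hR _ ?_ Pt hPt) u v t
  rw [List.getD_eq_getElem?_getD, List.getElem?_eq_getElem hg, Option.getD_some]
  exact List.getElem_mem hg

/-- **Soundness of the energy certificate checker (Cohn–Woo 2012, Theorem 3.2, kernel form).**
If `c` passes the side, identity and value checks with validated expansions `P`, then every
configuration `C` of `c.N` unit vectors of `ℝⁿ` (`n = c.n`) has `p`-energy (ordered pairs) at least
`bNum/bDen`. [cite: CohnWoo2012, Theorem 3.2] -/
theorem energy_ge_of_certE (c : CertE) (P : PolysE) (hP : PolysOKE c P) (hs : checkSideE c = true)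
    (hid : checkIdE c P = true) (hv : checkValE c P = true)
    (C : Finset (EuclideanSpace ℝ (Fin c.n))) (hC : ∀ x ∈ C, ‖x‖ = 1) (hN : C.card = c.N) :
    bval c ≤ ∑ x ∈ C, ∑ y ∈ C.erase x, pval c (inner ℝ x y) := by
  classical
  obtain ⟨hn, hN3, hLam, -, -, -, -, -, -, hF, -, -⟩ := sideE_of_check c hs
  have hcard : 3 ≤ C.card := by rw [hN]; exact hN3
  have hl : (0 : ℝ) < c.Lam := by exact_mod_cast hLam
  -- positivity of the two- and three-point parts
  have hA : 0 ≤ BachocVallentin.pairSum C (AXE c) := by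
    have h0 := pairSum_AvalG_nonneg (by omega : 3 ≤ c.n) c.A C hC
    unfold AXE BachocVallentin.pairSum at *
    have e : (∑ x ∈ C, ∑ y ∈ C, AvalG c.n c.A (inner ℝ x y) / (c.lamA : ℝ))
        = (∑ x ∈ C, ∑ y ∈ C, AvalG c.n c.A (inner ℝ x y)) / (c.lamA : ℝ) := by
      rw [Finset.sum_div]; refine Finset.sum_congr rfl fun x _ => ?_
      rw [Finset.sum_div]
    rw [e]; exact div_nonneg h0 (by positivity)
  have hF3 : 0 ≤ BachocVallentin.tripleSum C (FXE c) := by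
    have h0 := tripleSum_FvalX_nonneg hn c.d c.F hF C hC
    unfold FXE BachocVallentin.tripleSum at *
    have e : (∑ x ∈ C, ∑ y ∈ C, ∑ z ∈ C,
        FvalX c.n c.F (inner ℝ x y) (inner ℝ x z) (inner ℝ y z) / (c.lamF : ℝ))
        = (∑ x ∈ C, ∑ y ∈ C, ∑ z ∈ C,
          FvalX c.n c.F (inner ℝ x y) (inner ℝ x z) (inner ℝ y z)) / (c.lamF : ℝ) := by
      rw [Finset.sum_div]; refine Finset.sum_congr rfl fun x _ => ?_
      rw [Finset.sum_div]; refine Finset.sum_congr rfl fun y _ => ?_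
      rw [Finset.sum_div]
    rw [e]; exact div_nonneg h0 (by positivity)
  have hF12 : ∀ u v t, FXE c u v t = FXE c v u t := fun u v t => by unfold FXE; rw [FvalX_swap12]
  have hF23 : ∀ u v t, FXE c u v t = FXE c u t v := fun u v t => by unfold FXE; rw [FvalX_swap23]
  -- the pointwise inequality from the identity (it holds for all real `u, v, t`)
  have hpt : ∀ u v t : ℝ, -1 ≤ u → u < 1 → -1 ≤ v → v < 1 → -1 ≤ t → t < 1 →
      0 ≤ 1 + 2 * u * v * t - u ^ 2 - v ^ 2 - t ^ 2 →
      cval c + ((C.card : ℝ) - 2) * FXE c u v t + FXE c u u 1 + FXE c v v 1 + FXE c t t 1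
        + (AXE c u + AXE c v + AXE c t) / 3 ≤ (pval c u + pval c v + pval c t) / 3 := by
    intro u v t _ _ _ _ _ _ _
    have hidv := identity_of_check c P hP hs hid u v t
    have hnn := groups_nonneg c P hP hs u v t
    have hcN : ((C.card : ℝ) - 2) = ((((c.N : ℤ) - 2 : ℤ) : ℝ)) := by rw [hN]; push_cast; ring
    rw [hcN]
    have key : 0 ≤ (c.Lam : ℝ) * ((pval c u + pval c v + pval c t) / 3 - cval c
        - ((((c.N : ℤ) - 2 : ℤ) : ℝ) * FXE c u v t + FXE c u u 1 + FXE c v v 1 + FXE c t t 1)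
        - (AXE c u + AXE c v + AXE c t) / 3) := by rw [hidv]; exact hnn
    have := (mul_nonneg_iff_of_pos_left hl).1 key
    linarith
  have h3 := CohnWoo.energy_ge_of_threePoint C hC hcard (pval c) (AXE c) (FXE c) (cval c) hA hF3 hF12 hF23 hpt
  rw [value_of_check c P hP hs hv]
  have hcN : (C.card : ℝ) = c.N := by rw [hN]
  rw [hcN] at h3
  exact h3

end Summit.Ventures.PackingBounds.Energy.ThreePointCertE

end
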